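import Mathlib
import Summits.AtomisticToContinuum.Crystallization.Theses.ChessboardParticlePlanes
import Summits.AtomisticToContinuum.Crystallization.Theorems.ChessboardParticlePlanesLjLaminarWindowsNSF
import HarnessLib

/-!
# Local non-spikiness — stub `stub_localNonSpiky` of line `Sketch` (skeleton rev. 17, lead c11), crux
`LjLaminarWindows` (stmt-AtomisticToContinuum-6711)

A particle `p` of a finite configuration `x : Fin N → ℝ³` is `θ`-spiky at `(L, R)` if its boundary shell
`{q : L − R < |x_q − x_p| ≤ L}` holds MORE than `θ · #{q : |x_q − x_p| ≤ L}` particles.  This file proves the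
LOCAL form of the non-spiky-fraction theorem: for `θ ∈ (0,1)`, `R ≥ 1` there is `L₀` such that for `L ≥ L₀`, in
every `7/10`-separated `23/20`-connected configuration, within `2L²` of any particle `p₀` that sees a particle
beyond distance `2L` there is a NON-spiky particle.  It is a two-line consequence of the landed Stage A mass bound
`stub_massBound` (all-spiky within `2L²` of `p₀` ⇒ the closed `2L`-ball at `p₀` holds `≤ M₁ L` particles) and the
landed Stage B contradiction `stub_sparseAllSpiky` (all-spiky within `L` of `p₀`, `2L`-ball mass `≤ M₁ L` and a far
particle is impossible), fed with `stub_thickCircle`, `nsf_bonferroni`, `stub_tripleShell` exactly as in `nsf_holds`.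
-/

noncomputable section

open scoped BigOperators
open Filter Topology
open Literature.MathematicalPhysics.StatisticalMechanics
open Summit.AtomisticToContinuum.Crystallization.Theorems.ChargedEnergyGapNegative

namespace Summit.AtomisticToContinuum.Crystallization.Theorems.LjLaminarWindowsSketch

/-- **Local non-spikiness (registered stub `stub_localNonSpiky` of skeleton rev. 17, line `Sketch`).**
For `θ ∈ (0,1)` and `R ≥ 1` there is `L₀` such that for every `L ≥ L₀`, in every finite `7/10`-separated
`23/20`-connected configuration, within `2L²` of any particle `p₀` that sees a particle beyond distance `2L`
there is a particle `p` whose boundary shell `L − R < |x_q − x_p| ≤ L` holds at most `θ ·` (its closed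
`L`-ball) particles.  Proof: with `M₁, L₁` from `stub_massBound stub_thickCircle nsf_bonferroni` and `L₂` from
`stub_sparseAllSpiky stub_thickCircle nsf_bonferroni stub_tripleShell`, take `L₀ = max (max L₁ L₂) 1`; if every
particle within `2L²` of `p₀` were spiky, Stage A bounds the closed `2L`-ball at `p₀` by `M₁ L` (taking `q = p₀`),
and Stage B at `a = p₀` (particles within `L ≤ 2L²` are spiky) gives `False`. [folklore] -/
theorem stub_localNonSpiky :
    ∀ θ R : ℝ, 0 < θ → θ < 1 → 1 ≤ R → ∃ L₀ : ℝ, ∀ L : ℝ, L₀ ≤ L → ∀ (N : ℕ) (x : Fin N → E3),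
      (∀ j k : Fin N, j ≠ k → (7 : ℝ) / 10 ≤ dist (x j) (x k)) →
      (∀ S : Finset (Fin N), S.Nonempty → Sᶜ.Nonempty →
          ∃ p ∈ S, ∃ k ∈ Sᶜ, dist (x p) (x k) ≤ 23 / 20) →
      ∀ p₀ : Fin N, (∃ j : Fin N, 2 * L < dist (x j) (x p₀)) →
        ∃ p : Fin N, dist (x p) (x p₀) ≤ 2 * L ^ 2 ∧
          ((Finset.univ.filter fun q : Fin N =>
              L - R < dist (x q) (x p) ∧ dist (x q) (x p) ≤ L).card : ℝ) ≤
            θ * ((Finset.univ.filter fun q : Fin N => dist (x q) (x p) ≤ L).card : ℝ) := by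
  intro θ R hθ hθ1 hR
  obtain ⟨M₁, L₁, hM₁, hA⟩ := stub_massBound stub_thickCircle nsf_bonferroni θ R hθ hθ1 hR
  obtain ⟨L₂, hB⟩ :=
    stub_sparseAllSpiky stub_thickCircle nsf_bonferroni stub_tripleShell θ R M₁ hθ hθ1 hR hM₁
  refine ⟨max (max L₁ L₂) 1, fun L hL N x hsep hconn p₀ hfar => ?_⟩
  have hL₁ : L₁ ≤ L := le_trans (le_trans (le_max_left L₁ L₂) (le_max_left _ 1)) hL
  have hL₂ : L₂ ≤ L := le_trans (le_trans (le_max_right L₁ L₂) (le_max_left _ 1)) hL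
  have hL1 : 1 ≤ L := le_trans (le_max_right _ 1) hL
  by_contra h
  push Not at h
  -- every particle within `2L²` of `p₀` is spiky
  have hspiky : ∀ p : Fin N, dist (x p) (x p₀) ≤ 2 * L ^ 2 →
      θ * ((Finset.univ.filter fun q : Fin N => dist (x q) (x p) ≤ L).card : ℝ) <
        ((Finset.univ.filter fun q : Fin N =>
          L - R < dist (x q) (x p) ∧ dist (x q) (x p) ≤ L).card : ℝ) :=
    fun p hp => h p hp
  -- Stage A: the closed `2L`-ball at `p₀` holds at most `M₁ L` particles
  have hball : ((Finset.univ.filter fun j : Fin N => dist (x j) (x p₀) ≤ 2 * L).card : ℝ) ≤ M₁ * L :=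
    hA L hL₁ N x hsep hconn p₀ hspiky p₀ (by rw [dist_self]; positivity)
  -- Stage B at `a = p₀`: particles within `L ≤ 2L²` of `p₀` are spiky
  have hL2 : L ≤ 2 * L ^ 2 := by nlinarith
  exact hB L hL₂ N x hsep hconn p₀ (fun p hp => hspiky p (le_trans hp hL2)) hball hfar

end Summit.AtomisticToContinuum.Crystallization.Theorems.LjLaminarWindowsSketch

end
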